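import Literature.AnabelianGeometry.SemiGraphs.TemperedHbddOfConfinedGeodesics
import Literature.AnabelianGeometry.SemiGraphs.TreeSystemGeodesicBaseEdges
import HarnessLib

/-!
# [SemiAnbd] Cor 3.9 (R3c) at ANY valence: a centralising element outside the verticial host crosses
# TWO base edges — eventually at every level

Mochizuki, *Semi-graphs of anabelioids*, Publ. RIMS **42** (2006), §3, Theorem 3.7 (iii) p. 41 and
Corollary 3.9, proof p. 43 l. 13 ("[again by Theorem 3.7, (iii), (iv)]"; the cell's step (R3c), FACT-LIST
rows F-2772 `EdgeLikeCentralizerAt` / F-2773 `EdgeLikeCentralizer`) [cite: MochizukiSemiAnbd2006, Cor 3.9 p.43].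

PROOF-ONLY (cell abc-iut, block F, seat abc-iut-f-172 gen 5; residual «infinite valence» of GAP row
G-t6g3-2b, memo HOME/staging/f/f-172/gen5/RETRACTION-STAR-F2773-memo.md §2; no definition, no named
fact).  Assembly of the seat's two bricks at the canonical tower `verticialLevelData_temperedPiChart` of a
countable `𝒢` satisfying the hypotheses of Thm. 3.7 (ANY valence):

* `TemperedHbddOfConfinedGeodesics.lean` (p468020): an element `g` centralising a compact `C ≠ 1` with
  verticial host `H ⊇ C` whose pair `(y, g·y)` is confined over ONE base edge lies in `H`;
* `TreeSystemGeodesicBaseEdges.lean` (p466880): the base edges met by the level geodesics of a compatible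
  pair of vertex systems only accumulate with the level.

Hence `exists_two_baseEdges_of_centralizer_not_mem`: **if `g` centralises `C` but `g ∉ H`, there are two
DISTINCT edges `ē₁ ≠ ē₂` of `𝔾` and a level `j₀` such that at EVERY level `j ≥ j₀` the geodesic
`[y_j, g·y_j]` of `𝔾̃_j` carries branches over `ē₁` AND over `ē₂`** — the escape of a centraliser is never
vertical over a single edge; at a vertex of infinite valence this leaves exactly the memo's case (II)
(a persistent FOREIGN base edge), whose sub-case (II-a) «recurring incoming branch type» is excluded by
abc-iut-w6-d062's per-pair depth lemma and whose sub-case (II-b) «branch types drifting to infinity with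
Chabauty accumulation at another branch group» is the residual of F-2772/F-2773.  Also recorded: the branch
form `exists_branch_geodesic_of_le` of the monotonicity (system level).

Honest framing: the ∀-closures F-2773 / F-1732 are NOT claimed; nothing here bears on [IUTchIII]
Cor. 3.12; typed ≠ proved elsewhere.
-/

namespace Literature.AnabelianGeometry.SemiGraphs

namespace SemiGraph

open CategoryTheory

universe v u

variable {J : Type v} [Preorder J]

/-- **Branch form of the monotonicity along an inverse system of trees**: every branch of the level-`i`
geodesic `[x i, x' i]` is the image of a branch of the level-`j` geodesic, `i ≤ j` (any path at level
`i`, any walk at level `j`). [cite: MochizukiSemiAnbd2006, Thm. 3.7(iii) p.41] -/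
theorem exists_branch_geodesic_of_le (T : J → SemiGraph.{u}) (hT : ∀ j, (T j).IsTree)
    (f : ∀ ⦃i j : J⦄, i ≤ j → (T j ⟶ T i)) (x x' : ∀ j, (T j).Vertex)
    (hx : ∀ ⦃i j : J⦄ (h : i ≤ j), (f h).vertexMap (x j) = x i)
    (hx' : ∀ ⦃i j : J⦄ (h : i ≤ j), (f h).vertexMap (x' j) = x' i) ⦃i j : J⦄ (h : i ≤ j)
    (qi : (T i).subdivision.Walk (Sum.inl (x i)) (Sum.inl (x' i))) (hqi : qi.IsPath)
    (qj : (T j).subdivision.Walk (Sum.inl (x j)) (Sum.inl (x' j)))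
    {b : (T i).Branch} (hb : (Sum.inr (Sum.inr b) : (T i).Node) ∈ qi.support) :
    ∃ b' : (T j).Branch, (Sum.inr (Sum.inr b') : (T j).Node) ∈ qj.support ∧ (f h).branchMap b' = b := by
  let qi' : (T i).subdivision.Walk (Sum.inl ((f h).vertexMap (x j))) (Sum.inl ((f h).vertexMap (x' j))) :=
    qi.copy (by rw [hx h]) (by rw [hx' h])
  have hqi' : qi'.IsPath := by simpa only [qi', SimpleGraph.Walk.isPath_copy] using hqi
  have hb' : (Sum.inr (Sum.inr b) : (T i).Node) ∈ qi'.support := by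
    simpa only [qi', SimpleGraph.Walk.support_copy] using hb
  exact exists_branch_mem_support_of_mem_geodesic (hT i).isTree.isAcyclic (f h) qj qi' hqi' hb'

end SemiGraph

namespace ProfiniteSemiGraph

open CategoryTheory Topology

universe u

variable (𝒢 : ProfiniteSemiGraph.{u}) (h37 : 𝒢.Thm37Hypotheses)

/-- The first step of a walk of the subdivision between the points of two distinct vertices is a branch
abutting to the origin. [cite: MochizukiSemiAnbd2006, §1 pp.11-12] -/
private theorem exists_branch_mem_support'' {T : SemiGraph.{u}} {y y' : T.Vertex} (hne : y ≠ y')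
    (p : T.subdivision.Walk (Sum.inl y) (Sum.inl y')) :
    ∃ β : T.Branch, T.abuts β = some y ∧ (Sum.inr (Sum.inr β) : T.Node) ∈ p.support := by
  cases p with
  | nil => exact (hne rfl).elim
  | cons h q =>
    obtain ⟨β, hβ, hq⟩ := (T.subdivision_adj_inl_iff y _).1 h
    subst hq
    exact ⟨β, hβ, by simp⟩

/-- **A base edge crossed by the geodesic of a compatible pair at one level is crossed at every higher
level** (canonical tower; branch form): if some branch of a path `[x_i, x'_i]` of `𝔾̃_i` lies over the base
edge `ē`, then for every `j ≥ i` every path `[x_j, x'_j]` of `𝔾̃_j` has a branch over `ē`.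
[cite: MochizukiSemiAnbd2006, Thm 3.7(iii) p.41] -/
theorem exists_branch_over_geodesic_of_le
    (x x' : ∀ j, ((verticialLevelData_temperedPiChart (h36 := h37.toProp36Hypotheses)).tree j).Vertex)
    (hx : ∀ ⦃i j : ℕ⦄ (hij : i ≤ j),
      ((verticialLevelData_temperedPiChart (h36 := h37.toProp36Hypotheses)).trans hij).vertexMap (x j) = x i)
    (hx' : ∀ ⦃i j : ℕ⦄ (hij : i ≤ j),
      ((verticialLevelData_temperedPiChart (h36 := h37.toProp36Hypotheses)).trans hij).vertexMap (x' j) = x' i)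
    ⦃i j : ℕ⦄ (hij : i ≤ j)
    (qi : ((verticialLevelData_temperedPiChart (h36 := h37.toProp36Hypotheses)).tree i).subdivision.Walk
      (Sum.inl (x i)) (Sum.inl (x' i))) (hqi : qi.IsPath)
    (qj : ((verticialLevelData_temperedPiChart (h36 := h37.toProp36Hypotheses)).tree j).subdivision.Walk
      (Sum.inl (x j)) (Sum.inl (x' j)))
    {b : ((verticialLevelData_temperedPiChart (h36 := h37.toProp36Hypotheses)).tree i).Branch}
    (hb : (Sum.inr (Sum.inr b) :
      ((verticialLevelData_temperedPiChart (h36 := h37.toProp36Hypotheses)).tree i).Node) ∈ qi.support) :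
    ∃ b' : ((verticialLevelData_temperedPiChart (h36 := h37.toProp36Hypotheses)).tree j).Branch,
      (Sum.inr (Sum.inr b') :
        ((verticialLevelData_temperedPiChart (h36 := h37.toProp36Hypotheses)).tree j).Node) ∈ qj.support ∧
      ((verticialLevelData_temperedPiChart (h36 := h37.toProp36Hypotheses)).proj j).edgeMap
          (((verticialLevelData_temperedPiChart (h36 := h37.toProp36Hypotheses)).tree j).edgeOf b') =
        ((verticialLevelData_temperedPiChart (h36 := h37.toProp36Hypotheses)).proj i).edgeMap
          (((verticialLevelData_temperedPiChart (h36 := h37.toProp36Hypotheses)).tree i).edgeOf b) := by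
  let D := verticialLevelData_temperedPiChart (𝒢 := 𝒢) (h36 := h37.toProp36Hypotheses)
  obtain ⟨b', hb', hbb'⟩ :=
    SemiGraph.exists_branch_geodesic_of_le D.tree D.isTree D.trans x x' hx hx' hij qi hqi qj hb
  refine ⟨b', hb', ?_⟩
  rw [← D.proj_edgeMap_trans hij, ← (D.trans hij).edgeOf_branchMap b', hbb']

/-- **A centralising element outside the verticial host crosses two base edges, eventually at every level**
([SemiAnbd] Thm 3.7 (iii) p. 41 / Cor 3.9 p. 43 l. 13, ANY valence).  At the canonical tower of a countable
`𝒢` satisfying the hypotheses of Thm. 3.7: let `C ≠ 1` be compact, `H ⊇ C` verticial with a compatible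
`H`-fixed vertex system `y`, and let `g` centralise `C` with `g ∉ H`.  Then there are edges `ē₁ ≠ ē₂` of `𝔾`
and a level `j₀` such that for every `j ≥ j₀` every path `[y_j, g·y_j]` of `𝔾̃_j` has a branch over `ē₁` and
a branch over `ē₂`.  (Twice the contrapositive of `mem_verticial_of_centralizer_of_confined`, then the
monotonicity `exists_branch_over_geodesic_of_le`.) [cite: MochizukiSemiAnbd2006, Cor 3.9 p.43] -/
theorem exists_two_baseEdges_of_centralizer_not_mem
    (C : Subgroup (𝒢.temperedPiChart h37.toProp36Hypotheses).G)
    (hCc : IsCompact (C : Set (𝒢.temperedPiChart h37.toProp36Hypotheses).G)) (hC : C ≠ ⊥)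
    {v : 𝒢.graph.Vertex} {H : Subgroup (𝒢.temperedPiChart h37.toProp36Hypotheses).G}
    (hH : H ∈ verticialSubgroups (𝒢.temperedPiChart h37.toProp36Hypotheses) v) (hCH : C ≤ H)
    (y : ∀ j, ((verticialLevelData_temperedPiChart (h36 := h37.toProp36Hypotheses)).tree j).Vertex)
    (hyc : ∀ ⦃i j : ℕ⦄ (hij : i ≤ j),
      ((verticialLevelData_temperedPiChart (h36 := h37.toProp36Hypotheses)).trans hij).vertexMap (y j) = y i)
    (hyH : ∀ h ∈ H, ∀ j,
      ((verticialLevelData_temperedPiChart (h36 := h37.toProp36Hypotheses)).act j h).hom.vertexMap (y j) = y j)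
    (g : (𝒢.temperedPiChart h37.toProp36Hypotheses).G)
    (hg : g ∈ Subgroup.centralizer (C : Set (𝒢.temperedPiChart h37.toProp36Hypotheses).G)) (hgH : g ∉ H) :
    ∃ (ē₁ ē₂ : 𝒢.graph.Edge) (j₀ : ℕ), ē₁ ≠ ē₂ ∧ ∀ (j : ℕ), j₀ ≤ j →
      ∀ (p : ((verticialLevelData_temperedPiChart (h36 := h37.toProp36Hypotheses)).tree j).subdivision.Walk
        (Sum.inl (y j))
        (Sum.inl (((verticialLevelData_temperedPiChart (h36 := h37.toProp36Hypotheses)).act j g).hom.vertexMap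
          (y j)))), p.IsPath →
      (∃ β : ((verticialLevelData_temperedPiChart (h36 := h37.toProp36Hypotheses)).tree j).Branch,
        (Sum.inr (Sum.inr β) :
          ((verticialLevelData_temperedPiChart (h36 := h37.toProp36Hypotheses)).tree j).Node) ∈ p.support ∧
        ((verticialLevelData_temperedPiChart (h36 := h37.toProp36Hypotheses)).proj j).edgeMap
          (((verticialLevelData_temperedPiChart (h36 := h37.toProp36Hypotheses)).tree j).edgeOf β) = ē₁) ∧
      (∃ β : ((verticialLevelData_temperedPiChart (h36 := h37.toProp36Hypotheses)).tree j).Branch,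
        (Sum.inr (Sum.inr β) :
          ((verticialLevelData_temperedPiChart (h36 := h37.toProp36Hypotheses)).tree j).Node) ∈ p.support ∧
        ((verticialLevelData_temperedPiChart (h36 := h37.toProp36Hypotheses)).proj j).edgeMap
          (((verticialLevelData_temperedPiChart (h36 := h37.toProp36Hypotheses)).tree j).edgeOf β) = ē₂) := by
  classical
  let D := verticialLevelData_temperedPiChart (𝒢 := 𝒢) (h36 := h37.toProp36Hypotheses)
  -- the translate system `g·y` is compatible
  have hy₁c := D.translate_compat' g hyc
  -- not confined over any single base edge (else `g ∈ H`)
  have hnot : ∀ e₀ : 𝒢.graph.Edge, ∃ (k : ℕ)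
      (p : (D.tree k).subdivision.Walk (Sum.inl (y k)) (Sum.inl ((D.act k g).hom.vertexMap (y k))))
      (_ : p.IsPath) (β : (D.tree k).Branch), (Sum.inr (Sum.inr β) : (D.tree k).Node) ∈ p.support ∧
        (D.proj k).edgeMap ((D.tree k).edgeOf β) ≠ e₀ := by
    intro e₀
    by_contra hall
    push Not at hall
    exact hgH (𝒢.mem_verticial_of_centralizer_of_confined h37 C hCc hC hH hCH y hyc hyH g hg e₀
      fun k p hp β hβ => hall k p hp β hβ)
  -- some level where `g` moves `y` (else `g` fixes `y`, hence `g ∈ H`)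
  obtain ⟨k₁, hk₁⟩ : ∃ k, (D.act k g).hom.vertexMap (y k) ≠ y k := by
    by_contra hall
    push Not at hall
    refine hgH (D.mem_of_adjacent_translates verticialDistinct_holds h37 hH y hyc hyH g ?_ ?_)
    · exact fun j hne => (hne (hall j)).elim
    · intro j hne
      exact (hne (by rw [hall j, hall j])).elim
  -- the level-`k₁` geodesic and its first branch, over `ē₁`
  have hT₁ := (D.isTree k₁).isTree
  let p₁ : (D.tree k₁).subdivision.Path (Sum.inl (y k₁)) (Sum.inl ((D.act k₁ g).hom.vertexMap (y k₁))) :=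
    (hT₁.connected _ _).some.toPath
  obtain ⟨β₁, -, hβ₁⟩ := exists_branch_mem_support'' (Ne.symm hk₁) p₁.1
  set ē₁ : 𝒢.graph.Edge := (D.proj k₁).edgeMap ((D.tree k₁).edgeOf β₁) with hē₁
  -- a level with a geodesic branch over some `ē₂ ≠ ē₁`
  obtain ⟨k₂, p₂, hp₂, β₂, hβ₂, hne⟩ := hnot ē₁
  set ē₂ : 𝒢.graph.Edge := (D.proj k₂).edgeMap ((D.tree k₂).edgeOf β₂) with hē₂
  refine ⟨ē₁, ē₂, max k₁ k₂, fun h => hne h.symm, fun j hj p hp => ⟨?_, ?_⟩⟩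
  · obtain ⟨β, hβ, hβe⟩ := 𝒢.exists_branch_over_geodesic_of_le h37 y (fun j => (D.act j g).hom.vertexMap (y j))
      hyc hy₁c ((le_max_left _ _).trans hj) p₁.1 p₁.2 p hβ₁
    exact ⟨β, hβ, hβe⟩
  · obtain ⟨β, hβ, hβe⟩ := 𝒢.exists_branch_over_geodesic_of_le h37 y (fun j => (D.act j g).hom.vertexMap (y j))
      hyc hy₁c ((le_max_right _ _).trans hj) p₂ hp₂ p hβ₂
    exact ⟨β, hβ, hβe⟩

end ProfiniteSemiGraph

end Literature.AnabelianGeometry.SemiGraphs
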